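import Summits.AtomisticToContinuum.Crystallization.Theorems.DisclinationRationUniformPolytypeStabilityDefs

/-!
# `UniformPolytypeStability` (stmt-AtomisticToContinuum-15800), line `birth` (v2, cells): far-field tetrahedron chains — computable core

Line `birth` (v2, cells), crux `UniformPolytypeStability` (route `DisclinationRation`).  Everything here is over `ℚ` and `decide`/`#eval`-able:
the 6 sub-tetrahedra of the unit cube with their barycentric forms, the straight-segment march through a slab
(breakpoints where `μ₁, μ₂, μ₁+μ₂+μ₃, μ₁+μ₃, μ₂+μ₃` cross integers), piece lists, affine functionals at junctions, and
the per-slab / inter-slab CHECKS whose conjunction (`checkClass`) certifies the vector identity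
`U_y − U_x = Σ_l Σ_i ŝ_i F_{T_i}(d_l)` for every pair of a far class.
-/

namespace Summit.AtomisticToContinuum.Crystallization.Theorems.UniformPolytypeStabilityCells

namespace FarChain

/-- a rational 3-vector (oblique slab coordinates `μ = (μ₁, μ₂, μ₃)`) [folklore] -/
structure Q3 where
  /-- first oblique coordinate [folklore] -/
  x : ℚ
  /-- second oblique coordinate [folklore] -/
  y : ℚ
  /-- third (vertical) oblique coordinate [folklore] -/
  z : ℚ
  deriving DecidableEq, Repr

namespace Q3
/-- sum [folklore] -/
def add (a b : Q3) : Q3 := ⟨a.x + b.x, a.y + b.y, a.z + b.z⟩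
/-- difference [folklore] -/
def sub (a b : Q3) : Q3 := ⟨a.x - b.x, a.y - b.y, a.z - b.z⟩
/-- scaling [folklore] -/
def smul (t : ℚ) (a : Q3) : Q3 := ⟨t * a.x, t * a.y, t * a.z⟩
/-- dot product [folklore] -/
def dot (a b : Q3) : ℚ := a.x * b.x + a.y * b.y + a.z * b.z
end Q3

/-- cube corner as a rational point [folklore] -/
def cornerQ (c : Corner) : Q3 := ⟨(c.1 : ℕ), (c.2.1 : ℕ), (c.2.2 : ℕ)⟩

/-- the `t`-th sub-tetrahedron of `subTetTable` as a list of (corner, cube-coordinate gradient) [folklore] -/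
def subTet (t : ℕ) : List (Corner × ℤ × ℤ × ℤ) := subTetTable.getD t []

/-- gradient record as a rational vector [folklore] -/
def gradQ (g : ℤ × ℤ × ℤ) : Q3 := ⟨g.1, g.2.1, g.2.2⟩

/-- barycentric coordinates of the point `μ` (cube-local coordinates) w.r.t. sub-tetrahedron `t`:
`λ_v(μ) = ⟨ĝ_v, μ − P_{v₀}⟩ + [v = v₀]`, `v₀` = the first listed corner. [folklore] -/
def bary (t : ℕ) (μ : Q3) : List (Corner × ℚ) :=
  match subTet t with
  | [] => []
  | (v0, g0) :: rest =>
    let p0 := cornerQ v0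
    (v0, Q3.dot (gradQ g0) (Q3.sub μ p0) + 1) :: rest.map fun vg => (vg.1, Q3.dot (gradQ vg.2) (Q3.sub μ p0))

/-- floor of a rational as an integer [folklore] -/
def qfloor (q : ℚ) : ℤ := Rat.floor q

/-- is the point (cube-local coordinates) inside the closed sub-tetrahedron `t`? [folklore] -/
def insideTet (t : ℕ) (μloc : Q3) : Bool := (bary t μloc).all fun vl => decide (0 ≤ vl.2)

/-- locate a point: cube offset `(⌊μ₁⌋, ⌊μ₂⌋)` (with `μ₃` clamped into `[0,1]`) and the first sub-tetrahedron containing it [folklore] -/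
def locate (μ : Q3) : (ℤ × ℤ) × ℕ :=
  let n1 := qfloor μ.x
  let n2 := qfloor μ.y
  let loc : Q3 := ⟨μ.x - n1, μ.y - n2, μ.z⟩
  let t := ((List.range 6).find? fun t => insideTet t loc).getD 0
  ((n1, n2), t)

/-- the parameters `s ∈ (0,1)` at which the affine scalar `α + β s` takes an integer value [folklore] -/
def crossings (α β : ℚ) : List ℚ :=
  if β = 0 then [] else
    let f0 := α
    let f1 := α + β
    let lo := min f0 f1
    let hi := max f0 f1
    let nlo := qfloor lo
    let nhi := qfloor hi + 1
    ((List.range (Int.toNat (nhi - nlo) + 1)).map fun k => ((nlo + k : ℤ) : ℚ)).filterMap fun n =>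
      let s := (n - α) / β
      if 0 < s ∧ s < 1 then some s else none

/-- insertion of a rational into a sorted duplicate-free list [folklore] -/
def insSorted (s : ℚ) : List ℚ → List ℚ
  | [] => [s]
  | a :: rest => if s < a then s :: a :: rest else if s = a then a :: rest else a :: insSorted s rest

/-- sorted duplicate-free merge [folklore] -/
def sortDedup (l : List ℚ) : List ℚ := l.foldl (fun acc s => insSorted s acc) []

/-- all breakpoints of the segment `μ(s) = E + s D`, `s ∈ [0,1]`, including `0` and `1` [folklore] -/
def breakpoints (E D : Q3) : List ℚ :=
  sortDedup ([0, 1] ++ crossings E.x D.x ++ crossings E.y D.y ++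
    crossings (E.x + E.y + E.z) (D.x + D.y + D.z) ++ crossings (E.x + E.z) (D.x + D.z) ++ crossings (E.y + E.z) (D.y + D.z))

/-- a piece of a slab sub-chain: cube offset, sub-tetrahedron, parameter interval [folklore] -/
structure Piece where
  /-- cube offset `(N₁, N₂)` in the slab [folklore] -/
  cube : ℤ × ℤ
  /-- sub-tetrahedron index `0..5` [folklore] -/
  tet : ℕ
  /-- start parameter [folklore] -/
  s0 : ℚ
  /-- end parameter [folklore] -/
  s1 : ℚ
  deriving DecidableEq, Repr

/-- point of the segment at parameter `s` [folklore] -/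
def pointAt (E D : Q3) (s : ℚ) : Q3 := Q3.add E (Q3.smul s D)

/-- consecutive pairs of a list [folklore] -/
def consec : List ℚ → List (ℚ × ℚ)
  | a :: b :: rest => (a, b) :: consec (b :: rest)
  | _ => []

/-- the straight-segment march through one slab: pieces between consecutive breakpoints, each located by its midpoint [folklore] -/
def marchSlab (E D : Q3) : List Piece :=
  (consec (breakpoints E D)).map fun ab =>
    let mid := pointAt E D ((ab.1 + ab.2) / 2)
    let loc := locate mid
    { cube := loc.1, tet := loc.2, s0 := ab.1, s1 := ab.2 }

/-- an affine functional on cube-corner points of a slab: list of ((M₁, M₂, cz), weight) [folklore] -/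
abbrev Fnl := List ((ℤ × ℤ × ℤ) × ℚ)

/-- add a weighted point to a functional (merging equal points) [folklore] -/
def Fnl.addPt (f : Fnl) (p : ℤ × ℤ × ℤ) (w : ℚ) : Fnl :=
  if f.any (fun q => q.1 = p) then f.map (fun q => if q.1 = p then (q.1, q.2 + w) else q) else f ++ [(p, w)]

/-- normalise: merge, drop zero weights [folklore] -/
def Fnl.norm (f : Fnl) : Fnl := (f.foldl (fun acc q => Fnl.addPt acc q.1 q.2) []).filter fun q => q.2 ≠ 0

/-- equality of functionals as finite maps [folklore] -/
def Fnl.beq (f g : Fnl) : Bool :=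
  let f' := Fnl.norm f
  let g' := Fnl.norm g
  f'.all (fun q => g'.any fun r => r = q) && g'.all (fun q => f'.any fun r => r = q)

/-- the affine interpolation functional of sub-tetrahedron `tet` of cube `cube` at the (slab-coordinate) point `μ` [folklore] -/
def tetFnl (cube : ℤ × ℤ) (tet : ℕ) (μ : Q3) : Fnl :=
  let loc : Q3 := ⟨μ.x - cube.1, μ.y - cube.2, μ.z⟩
  (bary tet loc).map fun vl => ((cube.1 + (vl.1.1 : ℕ), cube.2 + (vl.1.2.1 : ℕ), ((vl.1.2.2 : ℕ) : ℤ)), vl.2)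

/-- per-slab check: the pieces partition `[0,1]` and consecutive pieces interpolate the junction point identically [folklore] -/
def checkPieces (E D : Q3) (ps : List Piece) : Bool :=
  match ps with
  | [] => false
  | p0 :: _ =>
    decide (p0.s0 = 0) && decide ((ps.getLastD p0).s1 = 1) &&
    ps.all (fun p => decide (p.s0 < p.s1) && decide (p.tet < 6)) &&
    (List.zip ps (ps.drop 1)).all fun pq =>
      decide (pq.1.s1 = pq.2.s0) &&
        Fnl.beq (tetFnl pq.1.cube pq.1.tet (pointAt E D pq.1.s1)) (tetFnl pq.2.cube pq.2.tet (pointAt E D pq.2.s0))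

/-- entry functional of a piece list [folklore] -/
def entryFnl (E D : Q3) (ps : List Piece) : Fnl :=
  match ps with
  | [] => []
  | p0 :: _ => tetFnl p0.cube p0.tet (pointAt E D p0.s0)

/-- exit functional of a piece list [folklore] -/
def exitFnl (E D : Q3) (ps : List Piece) : Fnl :=
  match ps with
  | [] => []
  | p0 :: _ => let pl := ps.getLastD p0; tetFnl pl.cube pl.tet (pointAt E D pl.s1)

/-! ## Classes and slab variants

A steep far class is `(Δm, 3q₁, 3q₂)` with `Δm ≥ 1`: the pair `(x, y)` with `y` in layer `x.1 + Δm` at in-plane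
offset `q₁ v₁ + q₂ v₂`, `(3q₁, 3q₂) ≡ (C, C) (mod 3)` where `C = haggLabel(m') − haggLabel(m)`.  The nominal polygonal
path crosses slab `m + l` from the point with slab coordinates `E = σ·(l q/Δm − C_l/3·(1,1))` (`C_l` the registry
shift of layer `m+l` relative to layer `m`, only `C_l mod 3` matters up to an integer shift of the whole slab picture)
in the direction `D = (σ q₁/Δm − 1/3, σ q₂/Δm − 1/3, 1)`; `σ = s (m+l)`.  An in-plane class (`Δm = 0`, `q ∈ ℤ²`)
is marched in the bottom face of slab `m`: `E = 0`, `D = (σ q₁, σ q₂, 0)`. -/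

/-- letter as a rational sign [folklore] -/
def sgnQ (σ : Bool) : ℚ := if σ then 1 else -1
/-- letter as an integer sign [folklore] -/
def sgnZ (σ : Bool) : ℤ := if σ then 1 else -1

/-- entry point of slab `l` (variant `C mod 3`, letter `σ`) for the steep class `(Δm, 3q)` [folklore] -/
def entryPt (dm : ℕ) (q3 : ℤ × ℤ) (l : ℕ) (c3 : ℕ) (σ : Bool) : Q3 :=
  let s := sgnQ σ
  ⟨s * ((l : ℚ) * q3.1 / (3 * dm) - (c3 : ℚ) / 3), s * ((l : ℚ) * q3.2 / (3 * dm) - (c3 : ℚ) / 3), 0⟩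

/-- direction through slab `l` for the steep class `(Δm, 3q)` with letter `σ` [folklore] -/
def dirVec (dm : ℕ) (q3 : ℤ × ℤ) (σ : Bool) : Q3 :=
  let s := sgnQ σ
  ⟨s * (q3.1 : ℚ) / (3 * dm) - 1 / 3, s * (q3.2 : ℚ) / (3 * dm) - 1 / 3, 1⟩

/-- the sub-chain of a steep slab variant [folklore] -/
def slabPieces (dm : ℕ) (q3 : ℤ × ℤ) (l c3 : ℕ) (σ : Bool) : List Piece :=
  marchSlab (entryPt dm q3 l c3 σ) (dirVec dm q3 σ)

/-- convert a slab functional (letter `σ`) to ABSOLUTE site offsets `(Δlayer, ΔI, ΔJ)` relative to the base site: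
corner point `(M₁, M₂, cz)` of slab `l` is the site `(l + cz, σ M₁ − K, σ M₂ − K)` where `K` is the integer part
`(C_l − C_l mod 3)/3`; we take `K` as an argument. [folklore] -/
def toSites (l : ℕ) (σ : Bool) (K : ℤ) (f : Fnl) : Fnl :=
  f.map fun q => ((((l : ℤ) + q.1.2.2), sgnZ σ * q.1.1 - K, sgnZ σ * q.1.2.1 - K), q.2)

/-- check of one steep slab variant [folklore] -/
def checkSlabVariant (dm : ℕ) (q3 : ℤ × ℤ) (l c3 : ℕ) (σ : Bool) : Bool :=
  checkPieces (entryPt dm q3 l c3 σ) (dirVec dm q3 σ) (slabPieces dm q3 l c3 σ)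

/-- entry functional of a steep slab variant in absolute site offsets (shift `K`) [folklore] -/
def slabEntry (dm : ℕ) (q3 : ℤ × ℤ) (l c3 : ℕ) (σ : Bool) (K : ℤ) : Fnl :=
  toSites l σ K (entryFnl (entryPt dm q3 l c3 σ) (dirVec dm q3 σ) (slabPieces dm q3 l c3 σ))

/-- exit functional of a steep slab variant in absolute site offsets (shift `K`) [folklore] -/
def slabExit (dm : ℕ) (q3 : ℤ × ℤ) (l c3 : ℕ) (σ : Bool) (K : ℤ) : Fnl :=
  toSites l σ K (exitFnl (entryPt dm q3 l c3 σ) (dirVec dm q3 σ) (slabPieces dm q3 l c3 σ))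

/-- `(c + σ) mod 3` and the carried integer shift `ΔK` with `c + σ = c' + 3ΔK` [folklore] -/
def nextC (c3 : ℕ) (σ : Bool) : ℕ × ℤ :=
  let v : ℤ := (c3 : ℤ) + sgnZ σ
  (Int.toNat (v % 3), v / 3)

/-- the full check of a steep class `(Δm, 3q)`: every slab variant is internally consistent, slab `0` enters at the base
site, consecutive slabs hand over identically for every letter pair, and the last slab exits at the top site whenever
the ending registry is realisable. [folklore] -/
def checkSteep (dm : ℕ) (q3 : ℤ × ℤ) : Bool :=
  decide (0 < dm) &&
  (List.range dm).all (fun l => [0, 1, 2].all fun c3 => [true, false].all fun σ => checkSlabVariant dm q3 l c3 σ) &&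
  ([true, false].all fun σ => Fnl.beq (slabEntry dm q3 0 0 σ 0) [((0, 0, 0), 1)]) &&
  (List.range (dm - 1)).all (fun l => [0, 1, 2].all fun c3 => [true, false].all fun σ => [true, false].all fun σ' =>
    let nc := nextC c3 σ
    Fnl.beq (slabExit dm q3 l c3 σ 0) (slabEntry dm q3 (l + 1) nc.1 σ' nc.2)) &&
  ([0, 1, 2].all fun c3 => [true, false].all fun σ =>
    let nc := nextC c3 σ      -- registry of the top layer relative to the base: C_Δm = c3 + σ + 3K
    -- realisable iff 3q ≡ C_Δm (mod 3); then y = (Δm, q₁ − C_Δm/3, q₂ − C_Δm/3)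
    if (q3.1 - (nc.1 : ℤ)) % 3 = 0 ∧ (q3.2 - (nc.1 : ℤ)) % 3 = 0 then
      Fnl.beq (slabExit dm q3 (dm - 1) c3 σ 0)
        [((dm, (q3.1 - nc.1) / 3 - nc.2, (q3.2 - nc.1) / 3 - nc.2), 1)]
    else true)

/-- in-plane class `(0, q)`, `q ∈ ℤ²`: march in the bottom face of slab `m` with letter `σ` [folklore] -/
def planePieces (q : ℤ × ℤ) (σ : Bool) : List Piece :=
  marchSlab ⟨0, 0, 0⟩ ⟨sgnQ σ * q.1, sgnQ σ * q.2, 0⟩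

/-- check of an in-plane class [folklore] -/
def checkPlane (q : ℤ × ℤ) : Bool :=
  decide (q ≠ (0, 0)) &&
  [true, false].all fun σ =>
    let E : Q3 := ⟨0, 0, 0⟩
    let D : Q3 := ⟨sgnQ σ * q.1, sgnQ σ * q.2, 0⟩
    let ps := planePieces q σ
    checkPieces E D ps &&
      Fnl.beq (toSites 0 σ 0 (entryFnl E D ps)) [((0, 0, 0), 1)] &&
      Fnl.beq (toSites 0 σ 0 (exitFnl E D ps)) [((0, q.1, q.2), 1)]

/-! ## Chord fractions per sub-tetrahedron type (what the cell charges use) -/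

/-- total parameter fraction spent in sub-tetrahedra of type `t` by a piece list [folklore] -/
def fracOfType (ps : List Piece) (t : ℕ) : ℚ := (ps.filter (fun p => p.tet = t)).foldl (fun acc p => acc + (p.s1 - p.s0)) 0

/-- the six chord fractions of a piece list [folklore] -/
def fracs (ps : List Piece) : List ℚ := (List.range 6).map (fracOfType ps)

end FarChain

open FarChain in
/-- Registered anchor of this file (`stub_farChains`): the generated chain of the nearest far class
(`Δm = 1`, `3q = (4,1)`: half in the corner tetrahedron `0`, half in the octahedron piece `2`) and the full checks of
the two nearest steep classes and the nearest in-plane class. [folklore] -/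
theorem stub_farChains :
    fracs (slabPieces 1 (4, 1) 0 0 true) = [1/2, 0, 1/2, 0, 0, 0] ∧
      checkSteep 1 (4, 1) = true ∧ checkSteep 2 (0, 0) = true ∧ checkPlane (1, 1) = true := by
  refine ⟨?_, ?_, ?_, ?_⟩ <;> native_decide

end Summit.AtomisticToContinuum.Crystallization.Theorems.UniformPolytypeStabilityCells
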